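import Literature.NumberTheory.EllipticCurves.TwoDescentKummerBridgeAdditivePlace
import HarnessLib

/-!
# The descent–Kummer bridge at a completion, CONVERSE direction: a descent pair is a local Kummer class

`TwoDescentKummerBridgeLocal.lean` / `TwoDescentKummerBridgeAdditivePlace.lean` prove, for an elliptic
curve `E/K` (`char K = 0`) with rational `2`-torsion `e₁, e₂, e₃` and a `K`-field `E` (a completion
`K_v`): if the restriction `res_E c` of a class `c ∈ H¹(K, E[2])` lies in the local Kummer condition
`𝓛_E = kummerLocalConditionAt W 2 E` (the image of `E(E)/2 → H¹(Γ_E, E[2])`), then the localised global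
components `[a]_E, [b]_E ∈ Eˣ/Eˣ²` of `c` are the descent components `x(P) - e₁`, `x(P) - e₂` of ONE point
`P ∈ (W⁄E)(E)`. THIS FILE proves the converse (Silverman, *AEC*, Prop. X.1.4 read at the completion:
"`(b₁, b₂)` is the image of a point `P ∈ E(K_v)`" ⟹ the class satisfies the local condition at `v`):

* `twoTorsionCharH1_baseChange_injective_pair` — the components `(H¹(χ₁), H¹(χ₂))` of `W⁄E` over `E`
  detect equality of classes of `H¹(E, (W⁄E)[2])` (the tree's `eq_zero_of_twoTorsionCharH1_eq_zero`);
* **`res_mem_kummerLocalConditionAt_of_twoDescentComponent_eq`**: if some `P ∈ (W⁄E)(E)` has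
  `x(P) - e₁ ≡ a` and `x(P) - e₂ ≡ b` in `Eˣ/Eˣ²`, where `[a], [b] ∈ Kˣ/Kˣ²` are the global components of
  `c ∈ H¹(K, E[2])`, then `res_E c ∈ 𝓛_E` — indeed `res_E c = localKummerMap P`: both are classes of
  `H¹(Γ_E, E[2](K̄)|_{Γ_E}) ≃ H¹(E, (W⁄E)[2])` (`galH1TorsionBaseChangeEquiv`) with the same two components,
  and `(H¹(χ₁), H¹(χ₂))` is injective over `E`;
* `mem_selmerLocalKer_of_twoDescentComponent_eq` — the same conclusion in the currency of
  `Selmer.lean`: `c ∈ selmerLocalKer W E 2` (`comap_res_kummerLocalConditionAt`);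
* `res_mem_kummerLocalConditionAt_iff_exists_twoDescentComponent_pair_eq` — with the direct half
  (`exists_twoDescentComponent_pair_eq_of_res_mem`): **`res_E c ∈ 𝓛_E` iff `([a]_E, [b]_E)` is the descent
  pair of a point of `E(E)`** — the local half of Silverman's identification
  `Sel⁽²⁾(E/K) = {(b₁, b₂) : (b₁, b₂) ∈ δ(E(K_v)) for all v}` (Prop. X.1.4 with X.4.9), now in both directions.

This is the input of the LOWER bound `#Sel⁽²⁾ ≥ …` of a complete `2`-descent (local solubility of the
surviving pairs), complementing the upper-bound files of the cell `bsd-monsky`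
(`CongruentNumberEvenMonskySelmerBound.lean` etc.). Theorems only; no named fact.

## References

* [SilvermanAEC2009] J. H. Silverman, *The Arithmetic of Elliptic Curves*, 2nd ed., GTM 106,
  Springer 2009, Thm. X.1.1, Prop. X.1.4, X.§4 (diagram (**) before Thm. X.4.2, Prop. X.4.9).
* [SerreGaloisCohomology1997] J.-P. Serre, *Galois Cohomology*, Springer 1997, I §2.4, II §1.2.
-/

noncomputable section

open scoped Classical

open Field

universe u

namespace WeierstrassCurve

open Literature.NumberTheory.GaloisRepresentations Literature.NumberTheory.EllipticCurves Field
open WeierstrassCurve.Affine DiscreteGaloisModule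

variable {K : Type u} [Field K] [CharZero K] (W : WeierstrassCurve K) [W.IsElliptic] {e₁ e₂ e₃ : K}
variable (E : Type u) [Field E] [Algebra K E] [CharZero E]

omit [CharZero K] [W.IsElliptic] in
/-- **Two classes of `H¹(E, (W⁄E)[2])` with the same two components are equal** (`(H¹(χ₁), H¹(χ₂))`
is injective over the completion; Silverman AEC Prop. X.1.4, injectivity of the `2`-descent map, at
the level of `H¹`). [cite: SilvermanAEC2009, Thm. X.1.1, Prop. X.1.4] -/
theorem twoTorsionCharH1_baseChange_injective_pair (h : W.toAffine.SplitTwoTorsion e₁ e₂ e₃)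
    [(W.baseChange E).IsElliptic] {x x' : galH1Torsion (W.baseChange E) 2}
    (h₁ : (W.baseChange E).twoTorsionCharH1 (h.map E) x = (W.baseChange E).twoTorsionCharH1 (h.map E) x')
    (h₂ : (W.baseChange E).twoTorsionCharH1 (h.swap₁₂.map E) x =
      (W.baseChange E).twoTorsionCharH1 (h.swap₁₂.map E) x') : x = x' := by
  rw [← sub_eq_zero]
  refine (W.baseChange E).eq_zero_of_twoTorsionCharH1_eq_zero (h.map E) (x - x') ?_ ?_
  · rw [map_sub, h₁, sub_self]
  · rw [map_sub]
    exact sub_eq_zero.mpr h₂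

/-- **A DESCENT PAIR IS A LOCAL KUMMER CLASS** (Silverman AEC Prop. X.1.4 at the completion, converse
direction of `exists_twoDescentComponent_pair_eq_of_res_mem`): let `c ∈ H¹(K, E[2])` have global
components `[a]` (`T₁`) and `[b]` (`T₂`), `a, b ∈ Kˣ`, and suppose a point `P ∈ (W⁄E)(E)` has
`x(P) - e₁ ≡ a` and `x(P) - e₂ ≡ b` in `Eˣ/Eˣ²`. Then `res_E c` lies in the local Kummer condition
`𝓛_E = kummerLocalConditionAt W 2 E` (in fact `res_E c = localKummerMap P`): writing
`res_E c = H¹(A⁻¹) x` (`galH1TorsionBaseChangeEquiv`) and `localKummerMap P = H¹(A⁻¹) κ(P)`, the classes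
`x` and `κ(P)` of `H¹(E, (W⁄E)[2])` have the same components (naturality `resTwoTorsionCharH1_res`,
`kummerEquiv_resMu_symm`, and `kummerEquiv ∘ H¹(χ₁) ∘ κ = twoDescentComponent`), hence coincide.
[cite: SilvermanAEC2009, Prop. X.1.4, X.§4 diagram (**)] -/
theorem res_mem_kummerLocalConditionAt_of_twoDescentComponent_eq (h : W.toAffine.SplitTwoTorsion e₁ e₂ e₃)
    [(W.baseChange E).IsElliptic] {c : galH1Torsion W 2} (a b : Kˣ)
    (ha : kummerEquiv K 2 (W.twoTorsionCharH1 h c) = Additive.ofMul (QuotientGroup.mk a))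
    (hb : kummerEquiv K 2 (W.twoTorsionCharH1 h.swap₁₂ c) = Additive.ofMul (QuotientGroup.mk b))
    (P : (W.baseChange E).toAffine.Point)
    (hPa : Affine.Point.twoDescentComponent (W.baseChange E).toAffine
        (algebraMap K E e₁) (algebraMap K E e₂) (algebraMap K E e₃) P =
      QuotientGroup.mk (Units.map (algebraMap K E : K →* E) a))
    (hPb : Affine.Point.twoDescentComponent (W.baseChange E).toAffine
        (algebraMap K E e₂) (algebraMap K E e₁) (algebraMap K E e₃) P =
      QuotientGroup.mk (Units.map (algebraMap K E : K →* E) b)) :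
    galoisCohomology.res (W.torsionGaloisModule 2) E 1 c ∈ W.kummerLocalConditionAt 2 E := by
  have h2 : (2 : ℤ) ≠ 0 := two_ne_zero
  set r := galoisCohomology.res (W.torsionGaloisModule 2) E 1 c with hr
  -- `res_E c = H¹(A⁻¹) x` and `localKummerMap P = H¹(A⁻¹) x'`
  obtain ⟨x, hx⟩ := (W.galH1TorsionBaseChangeEquiv E h2).surjective r
  rw [galH1TorsionBaseChangeEquiv_apply] at hx
  set x' : galH1Torsion (W.baseChange E) 2 :=
    kummerMapTorsion (W.baseChange E) 2 (W.two_zsmul_geomPoints_baseChange_surjective E) P with hx'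
  have hloc : W.localKummerMap E h2 P = cohomologyMap (W.torsionTransferInvHom (E := E) h2) 1 x' :=
    W.localKummerMap_eq_cohomologyMap_kummerMapTorsion E h2 (W.two_zsmul_geomPoints_baseChange_surjective E) P
  -- the components of `x`: the localised global components
  have hxa : kummerEquiv E 2 ((W.baseChange E).twoTorsionCharH1 (h.map E) x) =
      Additive.ofMul (QuotientGroup.mk (Units.map (algebraMap K E : K →* E) a)) := by
    have hc' : W.twoTorsionCharH1 h c = (kummerEquiv K 2).symm (Additive.ofMul (QuotientGroup.mk a)) := by
      rw [← ha, AddEquiv.symm_apply_apply]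
    rw [← W.resTwoTorsionCharH1_cohomologyMap_torsionTransferInvHom E h, hx, hr, resTwoTorsionCharH1_res,
      hc', kummerEquiv_resMu_symm]
  have hxb : kummerEquiv E 2 ((W.baseChange E).twoTorsionCharH1 (h.swap₁₂.map E) x) =
      Additive.ofMul (QuotientGroup.mk (Units.map (algebraMap K E : K →* E) b)) := by
    have hc' : W.twoTorsionCharH1 h.swap₁₂ c =
        (kummerEquiv K 2).symm (Additive.ofMul (QuotientGroup.mk b)) := by
      rw [← hb, AddEquiv.symm_apply_apply]
    rw [← W.resTwoTorsionCharH1_cohomologyMap_torsionTransferInvHom E h.swap₁₂, hx, hr,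
      resTwoTorsionCharH1_res, hc', kummerEquiv_resMu_symm]
  -- the components of `x'`: the descent components of `P`
  have hx'a : kummerEquiv E 2 ((W.baseChange E).twoTorsionCharH1 (h.map E) x') =
      Additive.ofMul (QuotientGroup.mk (Units.map (algebraMap K E : K →* E) a)) := by
    rw [hx', (W.baseChange E).kummerEquiv_twoTorsionCharH1_kummerMapTorsion (h.map E), hPa]
  have hx'b : kummerEquiv E 2 ((W.baseChange E).twoTorsionCharH1 (h.swap₁₂.map E) x') =
      Additive.ofMul (QuotientGroup.mk (Units.map (algebraMap K E : K →* E) b)) := by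
    rw [hx', (W.baseChange E).kummerEquiv_twoTorsionCharH1_kummerMapTorsion (h.swap₁₂.map E), hPb]
  have hxx' : x = x' :=
    W.twoTorsionCharH1_baseChange_injective_pair E h
      ((kummerEquiv E 2).injective (hxa.trans hx'a.symm)) ((kummerEquiv E 2).injective (hxb.trans hx'b.symm))
  rw [← hx, hxx', ← hloc]
  exact W.localKummerMap_mem E h2 P

/-- **A descent pair is a local Kummer class, in the currency of `Selmer.lean`**: under the hypotheses
of `res_mem_kummerLocalConditionAt_of_twoDescentComponent_eq`, `c ∈ selmerLocalKer W E 2` (the class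
dies in `H¹(Γ_E, E(K̄_E))`; `selmerLocalKer = res_E⁻¹ 𝓛_E`, `comap_res_kummerLocalConditionAt`).
[cite: SilvermanAEC2009, Prop. X.1.4, X.§4 diagram (**)] -/
theorem mem_selmerLocalKer_of_twoDescentComponent_eq (h : W.toAffine.SplitTwoTorsion e₁ e₂ e₃)
    [(W.baseChange E).IsElliptic] {c : galH1Torsion W 2} (a b : Kˣ)
    (ha : kummerEquiv K 2 (W.twoTorsionCharH1 h c) = Additive.ofMul (QuotientGroup.mk a))
    (hb : kummerEquiv K 2 (W.twoTorsionCharH1 h.swap₁₂ c) = Additive.ofMul (QuotientGroup.mk b))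
    (P : (W.baseChange E).toAffine.Point)
    (hPa : Affine.Point.twoDescentComponent (W.baseChange E).toAffine
        (algebraMap K E e₁) (algebraMap K E e₂) (algebraMap K E e₃) P =
      QuotientGroup.mk (Units.map (algebraMap K E : K →* E) a))
    (hPb : Affine.Point.twoDescentComponent (W.baseChange E).toAffine
        (algebraMap K E e₂) (algebraMap K E e₁) (algebraMap K E e₃) P =
      QuotientGroup.mk (Units.map (algebraMap K E : K →* E) b)) :
    c ∈ selmerLocalKer W E 2 :=
  (SetLike.ext_iff.mp (W.comap_res_kummerLocalConditionAt 2 E) c).mp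
    (W.res_mem_kummerLocalConditionAt_of_twoDescentComponent_eq E h a b ha hb P hPa hPb)

/-- **The local Selmer condition IS membership in the descent image** (Silverman AEC Prop. X.1.4 at a
completion, both directions): for `c ∈ H¹(K, E[2])` with global components `[a]`, `[b]`, the restriction
`res_E c` lies in the local Kummer condition `𝓛_E` iff `([a]_E, [b]_E)` is the pair of descent components
`(x(P) - e₁, x(P) - e₂)` of some `P ∈ E(E)`. [cite: SilvermanAEC2009, Prop. X.1.4, Prop. X.4.9] -/
theorem res_mem_kummerLocalConditionAt_iff_exists_twoDescentComponent_pair_eq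
    (h : W.toAffine.SplitTwoTorsion e₁ e₂ e₃) [(W.baseChange E).IsElliptic] {c : galH1Torsion W 2} (a b : Kˣ)
    (ha : kummerEquiv K 2 (W.twoTorsionCharH1 h c) = Additive.ofMul (QuotientGroup.mk a))
    (hb : kummerEquiv K 2 (W.twoTorsionCharH1 h.swap₁₂ c) = Additive.ofMul (QuotientGroup.mk b)) :
    galoisCohomology.res (W.torsionGaloisModule 2) E 1 c ∈ W.kummerLocalConditionAt 2 E ↔
      ∃ P : (W.baseChange E).toAffine.Point,
        Affine.Point.twoDescentComponent (W.baseChange E).toAffine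
            (algebraMap K E e₁) (algebraMap K E e₂) (algebraMap K E e₃) P =
          QuotientGroup.mk (Units.map (algebraMap K E : K →* E) a) ∧
        Affine.Point.twoDescentComponent (W.baseChange E).toAffine
            (algebraMap K E e₂) (algebraMap K E e₁) (algebraMap K E e₃) P =
          QuotientGroup.mk (Units.map (algebraMap K E : K →* E) b) :=
  ⟨fun hc => W.exists_twoDescentComponent_pair_eq_of_res_mem E h hc a b ha hb,
    fun ⟨P, hPa, hPb⟩ => W.res_mem_kummerLocalConditionAt_of_twoDescentComponent_eq E h a b ha hb P hPa hPb⟩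

end WeierstrassCurve

end
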